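import Literature.MathematicalPhysics.QuantumLattice.RepKillingForm
import Mathlib.Analysis.SpecialFunctions.Pow.Asymptotics
import Mathlib.Analysis.SpecialFunctions.Log.Deriv
import Mathlib.Analysis.Calculus.Deriv.MeanValue
import HarnessLib

/-!
# The one- and two-loop coefficients `b₀(G, r)`, `b₁(G, r)` and the two-loop asymptotic-freedom scale
# of the Wilson action `exp(β ∑ₚ Re tr r(U_p))` for a general compact gauge group

Topic `Literature/MathematicalPhysics/QuantumFieldTheory`. The tree's `YangMillsOS.lean` types pure
Yang–Mills for an ABSTRACT compact simple group `G` presented by lattice representation data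
`r : LatticeRep G`, with Wilson weight `exp(β ∑ₚ Re tr r(U_p))`, and records as an open strengthening
that "the two-loop profile … needs the one- and two-loop coefficients `b₀ = 11 C₂(G)/(48π²)`, `b₁` in
the normalisation fixed by `r`, i.e. Lie-algebra data … that the tree does not carry for an abstract
compact group `G`". The `SU(2)` spine (`Theorems/FemtoTransferGap.lean`) hard-codes `b0 = 11/(24π²)`,
`b1 = 17/(96π⁴)` for the bare coupling `g₀² = 2/β` and the size label
`sizeLog β L = log L − β/(4 b0) − (b1/(2 b0²)) log(2 b0/β)`.

This file supplies the `G`-general data, built on the adjoint-Casimir ratio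
`λ(G, r) = casimirRatio r = −K(X,X)/Re tr(X*X)` of `RepKillingForm.lean`:

* **Normalisation (derivation, recorded once).** Write `U_p = exp(a²F)` with `F ∈ 𝔤_r` skew-Hermitian.
  Then `N − Re tr r(U_p) = (a⁴/2)·⟨F,F⟩ + O(a⁶)` with `⟨X,Y⟩ := Re tr(X*Y) = −Re tr(XY)`, so the tree's
  action `β ∑ₚ (N − Re tr r(U_p))` is `(1/(4g̃²)) ∫ ∑_{μν} ⟨F_{μν},F_{μν}⟩` with **`g̃² = 1/β`**. In an
  orthonormal basis `T^a` of `(𝔤_r, ⟨·,·⟩)` the structure constants give `f^{acd}f^{bcd} = −K(T^a,T^b)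
  = λ(G,r) δ^{ab}`, i.e. the adjoint Casimir in THIS inner product is `C₂(G) = λ(G, r)`; the universal
  coefficients `β(g̃) = −b₀ g̃³ − b₁ g̃⁵ − …`, `b₀ = (11/3) C₂/(16π²)`, `b₁ = (34/3) C₂²/(16π²)²`
  (Gross–Wilczek, Politzer; Caswell, Jones) become
  **`b₀(G,r) = 11 λ/(48π²)`** (`LatticeRep.afCoeff₀`) and **`b₁(G,r) = 17 λ²/(384π⁴)`**
  (`LatticeRep.afCoeff₁`); the two-loop exponent `b₁/(2b₀²) = 51/121` is universal
  (`afCoeff₁_div_two_mul_sq`). (For `SU(N)` these are Montvay–Münster (3.261)–(3.262) with `N ↦ C₂(G)`;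
  the general-`G` form with the adjoint Casimir is standard.) Check: `SU(N)` fundamental has `λ = 2N`
  (`K = 2N tr(XY)`, Humphreys §6 Exercise 7), so
  `b₀ = 22N/(48π²) = 2·(11N/(48π²))`, `b₁ = 4·(34N²/(3(16π²)²))` — the standard coefficients of
  `g₀² = 2g̃² = 2/β`, rescaled by `g̃ = g₀/√2`; at `N = 2`: `afCoeff₀ = 11/(12π²) = 2·b0`,
  `afCoeff₁ = 17/(24π⁴) = 4·b1` (`afCoeff₀_fundamentalLatticeRep_two`, `afCoeff₁_fundamentalLatticeRep_two`,
  using `casimirRatio (fundamentalLatticeRep 2) = 4` of `RepKillingForm.lean`).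
* **The two-loop asymptotic-freedom scale** (lattice spacing in units of the lattice `Λ`-parameter,
  Hasenfratz–Hasenfratz 1980, Dashen–Gross 1981): `a(β)Λ_L ≃ (b₀g̃²)^{−b₁/(2b₀²)} e^{−1/(2b₀g̃²)}`, typed
  as the everywhere-positive `afScale b₀ b₁ β = exp(afLogScale b₀ b₁ β)` with
  `afLogScale b₀ b₁ β = −β/(2b₀) + (b₁/(2b₀²)) log(β/b₀)`, and `LatticeRep.afUnit r = afScale b₀(G,r) b₁(G,r)`.
  For the `SU(2)` fundamental representation `afLogScale (2 b0) (4 b1) β = sizeLog β 1` of the spine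
  identically in `β` (`afLogScale_two_mul_four_mul`, the shape used by `FemtoTransferGap.sizeLog`).
* **Elementary properties** (`0 < b₀`): `afScale_pos`; `tendsto_afScale_atTop` (`a(β)Λ → 0`);
  the ratio law `afScale b₀ b₁ c / afScale b₀ b₁ (c + t) → exp(t/(2b₀))` (`tendsto_afScale_div_afScale_add`;
  `κ = 1/(2b₀)` in the language of route `ForcedResponseSkewness`); strict antitonicity on
  `{β | 0 < β ∧ b₁/b₀ ≤ β}` (`strictAntiOn_afScale`).

Honest scope: these are DEFINITIONS and calculus; no statement about any lattice measure is made, and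
whether the correlation length of the Wilson theory follows `afUnit r` (asymptotic scaling) is exactly
the open physics. The value `λ(G,r)` is meaningful (`= C₂(ad)` in the trace normalisation) when the two
invariant forms are proportional (compact simple `G`, `HasCasimirRatio`), see `RepKillingForm.lean`.

**Sources (read at the cited places).** I. Montvay, G. Münster, *Quantum Fields on a Lattice* (1994)
[MontvayMunster1994], §3: (3.260)–(3.262) `β_LAT(g) = −β₀g³ − β₁g⁵ + …`, `β₀ = (N/16π²)(11/3)`,
`β₁ = (N/16π²)²(34/3)`; (3.263)–(3.265) `a = Λ_LAT⁻¹ exp(−1/(2β₀g²)) (β₀g²)^{−β₁/(2β₀²)} {1 + O(g²)}`,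
"`Λ_LAT` … is called the lattice `Λ`-parameter". A. Hasenfratz, P. Hasenfratz, Phys. Lett. B 93 (1980)
165 [HasenfratzHasenfratz1980], pp. 165–166 (as cited by the tree's `FemtoTransferGap.sizeLog`).
Historical: Gross–Wilczek, Politzer (1973) for `b₀`; Caswell, Jones (1974) for `b₁`.
-/

noncomputable section

open Real Filter Topology
open Literature.MathematicalPhysics.QuantumLattice (casimirRatio casimirRatio_fundamentalLatticeRep_two
  fundamentalLatticeRep)

namespace Literature.MathematicalPhysics.QuantumFieldTheory

/-! ### §1 The coefficients `b₀(G, r)`, `b₁(G, r)` -/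

section Coefficients

variable {G : Type*} [Group G] [TopologicalSpace G] [CompactSpace G]

/-- **The one-loop coefficient `b₀(G, r) = 11 λ(G,r)/(48π²)`** of the coupling `g̃² = 1/β` of the
Wilson weight `exp(β ∑ₚ Re tr r(U_p))` (`= 11 C₂(G)/(48π²)` with `C₂` the adjoint Casimir in the trace
inner product `Re tr(X*Y)` of `r`; `22N/(48π²)` for the fundamental representation of `SU(N)` —
Montvay–Münster's `β₀ = (N/16π²)(11/3)` for the coupling `g₀² = 2/β`, rescaled to `g̃² = g₀²/2`).
[cite: MontvayMunster1994, (3.261)] -/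
def LatticeRep.afCoeff₀ (r : LatticeRep G) : ℝ := 11 * casimirRatio r / (48 * π ^ 2)

/-- **The two-loop coefficient `b₁(G, r) = 17 λ(G,r)²/(384π⁴)`** (`= 34 C₂²/(3 (16π²)²)`; Montvay–Münster's
`β₁ = (N/16π²)²(34/3)` rescaled to `g̃²`) of the same coupling. [cite: MontvayMunster1994, (3.262)] -/
def LatticeRep.afCoeff₁ (r : LatticeRep G) : ℝ := 17 * casimirRatio r ^ 2 / (384 * π ^ 4)

/-- Unfolding `afCoeff₀`. [cite: MontvayMunster1994, (3.261)] -/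
theorem LatticeRep.afCoeff₀_def (r : LatticeRep G) : r.afCoeff₀ = 11 * casimirRatio r / (48 * π ^ 2) := rfl

/-- Unfolding `afCoeff₁`. [cite: MontvayMunster1994, (3.262)] -/
theorem LatticeRep.afCoeff₁_def (r : LatticeRep G) :
    r.afCoeff₁ = 17 * casimirRatio r ^ 2 / (384 * π ^ 4) := rfl

/-- `b₀(G, r) > 0` as soon as `λ(G, r) > 0` (asymptotic freedom of pure gauge theory). [cite: MontvayMunster1994, (3.261)] -/
theorem LatticeRep.afCoeff₀_pos {r : LatticeRep G} (h : 0 < casimirRatio r) : 0 < r.afCoeff₀ := by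
  rw [LatticeRep.afCoeff₀_def]
  positivity

/-- **The two-loop exponent is universal**: `b₁/(2b₀²) = 51/121` for every `(G, r)` with `λ(G,r) ≠ 0`
(`C₂²` cancels). [cite: MontvayMunster1994, (3.262)] -/
theorem LatticeRep.afCoeff₁_div_two_mul_sq {r : LatticeRep G} (h : casimirRatio r ≠ 0) :
    r.afCoeff₁ / (2 * r.afCoeff₀ ^ 2) = 51 / 121 := by
  rw [LatticeRep.afCoeff₀_def, LatticeRep.afCoeff₁_def]
  have hπ : (π : ℝ) ≠ 0 := Real.pi_ne_zero
  field_simp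
  ring

/-- **Calibration `SU(2)`, fundamental: `b₀ = 11/(12π²)`** — twice the spine's `b0 = 11/(24π²)` of
`g₀² = 2/β` (`g̃² = g₀²/2`). [cite: HasenfratzHasenfratz1980, p. 165] -/
theorem afCoeff₀_fundamentalLatticeRep_two :
    (fundamentalLatticeRep 2).afCoeff₀ = 11 / (12 * π ^ 2) := by
  rw [LatticeRep.afCoeff₀_def, casimirRatio_fundamentalLatticeRep_two]
  ring

/-- **Calibration `SU(2)`, fundamental: `b₁ = 17/(24π⁴)`** — four times the spine's `b1 = 17/(96π⁴)`.
[cite: HasenfratzHasenfratz1980, p. 165] -/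
theorem afCoeff₁_fundamentalLatticeRep_two :
    (fundamentalLatticeRep 2).afCoeff₁ = 17 / (24 * π ^ 4) := by
  rw [LatticeRep.afCoeff₁_def, casimirRatio_fundamentalLatticeRep_two]
  ring

end Coefficients

/-! ### §2 The two-loop asymptotic-freedom scale `a(β)Λ_L` -/

section Scale

/-- **Logarithm of the two-loop scale**: `log(a(β)Λ_L) = −1/(2b₀g̃²) − (b₁/(2b₀²)) log(b₀g̃²)` at
`g̃² = 1/β`, i.e. `−β/(2b₀) + (b₁/(2b₀²)) log(β/b₀)` (junk-free: `Real.log` is total): the logarithm of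
Montvay–Münster's `exp(−1/(2β₀g²)) (β₀g²)^{−β₁/(2β₀²)}` defining `Λ_LAT`.
[cite: MontvayMunster1994, (3.265)] [cite: HasenfratzHasenfratz1980, pp. 165–166] -/
def afLogScale (b₀ b₁ β : ℝ) : ℝ := -(β / (2 * b₀)) + b₁ / (2 * b₀ ^ 2) * Real.log (β / b₀)

/-- **The two-loop asymptotic-freedom scale** `a(β)Λ_L = exp(afLogScale b₀ b₁ β)` — positive for every
real `β`. [cite: MontvayMunster1994, (3.265)] -/
def afScale (b₀ b₁ β : ℝ) : ℝ := Real.exp (afLogScale b₀ b₁ β)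

/-- Unfolding `afLogScale`. [cite: MontvayMunster1994, (3.265)] -/
theorem afLogScale_def (b₀ b₁ β : ℝ) :
    afLogScale b₀ b₁ β = -(β / (2 * b₀)) + b₁ / (2 * b₀ ^ 2) * Real.log (β / b₀) := rfl

/-- Unfolding `afScale`. [cite: MontvayMunster1994, (3.265)] -/
theorem afScale_def (b₀ b₁ β : ℝ) : afScale b₀ b₁ β = Real.exp (afLogScale b₀ b₁ β) := rfl

/-- `a(β)Λ_L > 0`. [cite: MontvayMunster1994, (3.265)] -/
theorem afScale_pos (b₀ b₁ β : ℝ) : 0 < afScale b₀ b₁ β := Real.exp_pos _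

/-- **The spine's shape**: `afLogScale (2b) (4b') β = −β/(4b) − (b'/(2b²)) log(2b/β)` for all real `β`
(with `b = b0`, `b' = b1` of `FemtoTransferGap` the right-hand side is `sizeLog β 1`). [cite: HasenfratzHasenfratz1980, pp. 165–166] -/
theorem afLogScale_two_mul_four_mul (b b' β : ℝ) :
    afLogScale (2 * b) (4 * b') β = -(β / (4 * b)) - b' / (2 * b ^ 2) * Real.log (2 * b / β) := by
  rw [afLogScale_def, ← inv_div β (2 * b), Real.log_inv]
  ring

variable {b₀ : ℝ}

/-- For `β > 0` (and `b₀ > 0`): `a(β)Λ_L = (β/b₀)^{b₁/(2b₀²)} · exp(−β/(2b₀))` (`= (b₀g̃²)^{−b₁/(2b₀²)} e^{−1/(2b₀g̃²)}`,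
`g̃² = 1/β`). [cite: MontvayMunster1994, (3.265)] -/
theorem afScale_eq_rpow_mul_exp (hb : 0 < b₀) (b₁ : ℝ) {β : ℝ} (hβ : 0 < β) :
    afScale b₀ b₁ β = (β / b₀) ^ (b₁ / (2 * b₀ ^ 2)) * Real.exp (-(β / (2 * b₀))) := by
  rw [afScale_def, afLogScale_def, Real.exp_add, Real.rpow_def_of_pos (div_pos hβ hb), mul_comm]
  ring_nf

/-- **`a(β)Λ_L → 0` as `β → ∞`** (`0 < b₀`): the continuum limit is at weak coupling. [cite: MontvayMunster1994, (3.265)] -/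
theorem tendsto_afScale_atTop (hb : 0 < b₀) (b₁ : ℝ) : Tendsto (afScale b₀ b₁) atTop (𝓝 0) := by
  have h1 : Tendsto (fun β : ℝ => β ^ (b₁ / (2 * b₀ ^ 2)) * Real.exp (-(1 / (2 * b₀)) * β)) atTop (𝓝 0) :=
    tendsto_rpow_mul_exp_neg_mul_atTop_nhds_zero _ (1 / (2 * b₀)) (by positivity)
  have h2 : Tendsto (fun β : ℝ => (b₀ ^ (b₁ / (2 * b₀ ^ 2)))⁻¹ *
      (β ^ (b₁ / (2 * b₀ ^ 2)) * Real.exp (-(1 / (2 * b₀)) * β))) atTop (𝓝 0) := by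
    simpa using h1.const_mul (b₀ ^ (b₁ / (2 * b₀ ^ 2)))⁻¹
  refine h2.congr' ?_
  filter_upwards [eventually_gt_atTop 0] with β hβ
  have he : -(1 / (2 * b₀)) * β = -(β / (2 * b₀)) := by ring
  rw [afScale_eq_rpow_mul_exp hb b₁ hβ, Real.div_rpow hβ.le hb.le, he]
  ring

/-- **The ratio law**: `a(c)Λ / a(c+t)Λ → exp(t/(2b₀))` as `c → ∞` (`0 < b₀`; the `exp(κt)`, `κ = 1/(2b₀)`,
of route `ForcedResponseSkewness`). [cite: MontvayMunster1994, (3.265)] -/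
theorem tendsto_afScale_div_afScale_add (hb : 0 < b₀) (b₁ t : ℝ) :
    Tendsto (fun c : ℝ => afScale b₀ b₁ c / afScale b₀ b₁ (c + t)) atTop
      (𝓝 (Real.exp (t / (2 * b₀)))) := by
  set κ : ℝ := b₁ / (2 * b₀ ^ 2) with hκ
  -- `log c − log (c + t) → 0`
  have hlog : Tendsto (fun c : ℝ => Real.log c - Real.log (c + t)) atTop (𝓝 0) := by
    have h := (Real.tendsto_log_comp_add_sub_log t).neg
    rw [neg_zero] at h
    refine h.congr' (Eventually.of_forall fun c => ?_)
    simp only [neg_sub]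
  have hexp : Tendsto (fun c : ℝ => Real.exp (t / (2 * b₀) + κ * (Real.log c - Real.log (c + t)))) atTop
      (𝓝 (Real.exp (t / (2 * b₀)))) := by
    have := ((hlog.const_mul κ).const_add (t / (2 * b₀)))
    rw [mul_zero, add_zero] at this
    exact (Real.continuous_exp.tendsto _).comp this
  refine hexp.congr' ?_
  filter_upwards [eventually_gt_atTop (max 0 (-t))] with c hc
  have hc0 : 0 < c := lt_of_le_of_lt (le_max_left _ _) hc
  have hct : 0 < c + t := by have := lt_of_le_of_lt (le_max_right _ _) hc; linarith
  rw [afScale_def, afScale_def, ← Real.exp_sub, afLogScale_def, afLogScale_def,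
    Real.log_div hc0.ne' hb.ne', Real.log_div hct.ne' hb.ne']
  congr 1
  ring

/-- The derivative of `afLogScale`: `d/dβ = −1/(2b₀) + (b₁/(2b₀²))/β` for `β ≠ 0`, `b₀ ≠ 0`. [cite: MontvayMunster1994, (3.265)] -/
theorem hasDerivAt_afLogScale (hb : b₀ ≠ 0) (b₁ : ℝ) {β : ℝ} (hβ : β ≠ 0) :
    HasDerivAt (afLogScale b₀ b₁) (-(1 / (2 * b₀)) + b₁ / (2 * b₀ ^ 2) * (1 / β)) β := by
  have h1 : HasDerivAt (fun x : ℝ => x / (2 * b₀)) (1 / (2 * b₀)) β :=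
    (hasDerivAt_id' β).div_const (2 * b₀)
  have h2 : HasDerivAt (fun x : ℝ => Real.log (x / b₀)) (1 / β) β := by
    have h := (Real.hasDerivAt_log (div_ne_zero hβ hb)).comp β ((hasDerivAt_id' β).div_const b₀)
    refine h.congr_deriv ?_
    field_simp
  have h3 : HasDerivAt (fun x : ℝ => -(x / (2 * b₀)) + b₁ / (2 * b₀ ^ 2) * Real.log (x / b₀))
      (-(1 / (2 * b₀)) + b₁ / (2 * b₀ ^ 2) * (1 / β)) β := h1.neg.add (h2.const_mul _)
  exact h3

/-- **Eventual strict antitonicity**: for `0 < b₀` the scale `a(β)Λ_L` is strictly decreasing in `β` on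
`{β | 0 < β ∧ b₁/b₀ ≤ β}` (the logarithmic derivative `−1/(2b₀) + b₁/(2b₀²β)` is negative past
`β = b₁/b₀`). [cite: MontvayMunster1994, (3.265)] -/
theorem strictAntiOn_afScale (hb : 0 < b₀) (b₁ : ℝ) :
    StrictAntiOn (afScale b₀ b₁) {β | 0 < β ∧ b₁ / b₀ ≤ β} := by
  have hconv : Convex ℝ {β : ℝ | 0 < β ∧ b₁ / b₀ ≤ β} := by
    have : {β : ℝ | 0 < β ∧ b₁ / b₀ ≤ β} = Set.Ioi 0 ∩ Set.Ici (b₁ / b₀) := by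
      ext β; simp [Set.mem_Ioi, Set.mem_Ici]
    rw [this]
    exact (convex_Ioi 0).inter (convex_Ici _)
  have hlog : StrictAntiOn (afLogScale b₀ b₁) {β | 0 < β ∧ b₁ / b₀ ≤ β} := by
    refine strictAntiOn_of_deriv_neg hconv ?_ ?_
    · intro β hβ
      exact (hasDerivAt_afLogScale hb.ne' b₁ hβ.1.ne').continuousAt.continuousWithinAt
    · intro β hβ
      have hβ' : β ∈ {β : ℝ | 0 < β ∧ b₁ / b₀ ≤ β} := interior_subset hβ
      -- interior points satisfy `b₁/b₀ < β`
      have hlt : b₁ / b₀ < β := by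
        have hopen : interior {β : ℝ | 0 < β ∧ b₁ / b₀ ≤ β} ⊆ Set.Ioi (b₁ / b₀) := by
          have hsub : {β : ℝ | 0 < β ∧ b₁ / b₀ ≤ β} ⊆ Set.Ici (b₁ / b₀) := fun β hβ => hβ.2
          exact (interior_mono hsub).trans (by rw [interior_Ici])
        exact hopen hβ
      rw [(hasDerivAt_afLogScale hb.ne' b₁ hβ'.1.ne').deriv]
      have hβ0 : 0 < β := hβ'.1
      have hkey : b₁ / (2 * b₀ ^ 2) * (1 / β) < 1 / (2 * b₀) := by
        rw [div_mul_div_comm, mul_one, div_lt_div_iff₀ (by positivity) (by positivity)]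
        have h1 : b₁ < β * b₀ := by rwa [div_lt_iff₀ hb] at hlt
        nlinarith
      linarith
  intro β hβ β' hβ' hlt
  exact Real.exp_lt_exp.2 (hlog hβ hβ' hlt)

end Scale

/-! ### §3 The scale of a lattice representation: `afUnit r = afScale b₀(G,r) b₁(G,r)` -/

section Unit

variable {G : Type*} [Group G] [TopologicalSpace G] [CompactSpace G]

/-- **The two-loop asymptotic-freedom unit of `(G, r)`**: `β ↦ a(β)Λ_L` with the coefficients
`b₀(G,r)`, `b₁(G,r)` of the Wilson weight `exp(β ∑ₚ Re tr r(U_p))` — the `G`-general form of the `SU(2)`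
spine's unit of record `exp(sizeLog β 1)` (same function at `G = SU(2)`, `r` fundamental, by
`afLogScale_two_mul_four_mul` and the calibration lemmas). [cite: MontvayMunster1994, (3.265)] -/
def LatticeRep.afUnit (r : LatticeRep G) (β : ℝ) : ℝ := afScale r.afCoeff₀ r.afCoeff₁ β

/-- Unfolding `afUnit`. [cite: MontvayMunster1994, (3.265)] -/
theorem LatticeRep.afUnit_def (r : LatticeRep G) (β : ℝ) :
    r.afUnit β = afScale r.afCoeff₀ r.afCoeff₁ β := rfl

/-- `afUnit r β > 0` for every real `β`. [cite: MontvayMunster1994, (3.265)] -/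
theorem LatticeRep.afUnit_pos (r : LatticeRep G) (β : ℝ) : 0 < r.afUnit β := afScale_pos _ _ _

/-- `afUnit r β → 0` as `β → ∞`, provided `λ(G, r) > 0`. [cite: MontvayMunster1994, (3.265)] -/
theorem LatticeRep.tendsto_afUnit_atTop {r : LatticeRep G} (h : 0 < casimirRatio r) :
    Tendsto r.afUnit atTop (𝓝 0) :=
  tendsto_afScale_atTop (LatticeRep.afCoeff₀_pos h) _

/-- The ratio law for `afUnit r`: `afUnit r c / afUnit r (c + t) → exp(t/(2 b₀(G,r)))`, `λ(G, r) > 0`.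
[cite: MontvayMunster1994, (3.265)] -/
theorem LatticeRep.tendsto_afUnit_div_afUnit_add {r : LatticeRep G} (h : 0 < casimirRatio r) (t : ℝ) :
    Tendsto (fun c : ℝ => r.afUnit c / r.afUnit (c + t)) atTop
      (𝓝 (Real.exp (t / (2 * r.afCoeff₀)))) :=
  tendsto_afScale_div_afScale_add (LatticeRep.afCoeff₀_pos h) _ t

/-- **`SU(2)` calibration of the unit**: for the fundamental representation of `SU(2)`,
`log (afUnit β) = −β/(4 b) − (b'/(2b²)) log(2b/β)` with `b = 11/(24π²)`, `b' = 17/(96π⁴)` — literally the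
spine's `FemtoTransferGap.sizeLog β 1` (`b = b0`, `b' = b1`). [cite: HasenfratzHasenfratz1980, pp. 165–166] -/
theorem afUnit_fundamentalLatticeRep_two (β : ℝ) :
    (fundamentalLatticeRep 2).afUnit β =
      Real.exp (-(β / (4 * (11 / (24 * π ^ 2)))) -
        (17 / (96 * π ^ 4)) / (2 * (11 / (24 * π ^ 2)) ^ 2) * Real.log (2 * (11 / (24 * π ^ 2)) / β)) := by
  rw [LatticeRep.afUnit_def, afScale_def, afCoeff₀_fundamentalLatticeRep_two,
    afCoeff₁_fundamentalLatticeRep_two,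
    show (11 / (12 * π ^ 2) : ℝ) = 2 * (11 / (24 * π ^ 2)) by ring,
    show (17 / (24 * π ^ 4) : ℝ) = 4 * (17 / (96 * π ^ 4)) by ring, afLogScale_two_mul_four_mul]

end Unit

end Literature.MathematicalPhysics.QuantumFieldTheory

end
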